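import Mathlib.Analysis.Complex.ExponentialBounds
import Summits.Ventures.WeilGRH.DualTrigLatticeCertMod19Class2One
import Summits.Ventures.WeilGRH.DualTrigLatticeCertMod19Class3One
import Summits.Ventures.WeilGRH.DualTrigCertMod19Class8One
import Summits.Ventures.WeilGRH.DualTrigCertMod19Class14One
import Summits.Ventures.WeilGRH.CellMod19One
import HarnessLib

/-!
# Every odd Dirichlet character mod 19: Weil positivity on `[−1, 1]`

Cell `rh-explicit`, WEIL TRACK — GRH ARM, route B (weil-grh-3, gen17).  Assembly (no kernel work) of the format-D-K instance files of the
odd key classes of the prime modulus 19 at `t = 1` (doors: `DKCert.check2`, the multi-lattice `DKCert3.checkL`, and for the real character the earlier landed file; files `DualTrigLatticeCertMod19Class2One`, `DualTrigLatticeCertMod19Class3One`, `DualTrigCertMod19Class8One`, `DualTrigCertMod19Class14One`, `CellMod19One`).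
Since `2` generates `(ℤ/19)ˣ` (order 18), `χ(2)^18 = 1`; for an odd character `χ(2)^9 = χ(−1) = −1`, so `χ(2) = e(k/18)` with `k` odd —
exactly the 9 certified characters (4 census classes and their conjugates).
Headline: `weilPositivityOnChar_mod19_one_of_odd` — for EVERY Dirichlet character `χ` mod 19 with `χ(−1) = −1` and every smooth `g`
supported in `[−1, 1]`, `Re W_χ(g ⋆ g̃) ≥ 0`.  Context: the arm's uniform `t = 1` floors cover every odd character of modulus `q ≥ 31`
(`weilPositivityOnChar_one_of_odd_ge_31`); 19 is in the odd remainder list of `UniformConductorFloorCoprimeRemainder`.  Honest scope: a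
theorem for these characters and this window only.  No named facts, no `sorry`; axioms standard.
-/

namespace Summit.Ventures.WeilGRH

open Literature.NumberTheory.LFunctions

/-- **Every ODD Dirichlet character mod 19 satisfies Weil positivity on `[−1, 1]`.**  `2` generates `(ℤ/19)ˣ`, `χ(2)^18 = 1`
and `χ(2)^9 = χ(−1) = −1`, so `χ(2) = e(k/18)` with `k` odd: one kernel-certified census class (or its conjugate) per case. [folklore] -/
theorem weilPositivityOnChar_mod19_one_of_odd (χ : DirichletCharacter ℂ 19) (hχ : χ.Odd) :
    WeilPositivityOnChar χ 1 := by
  have h18 : χ (2 : ZMod 19) ^ 18 = 1 := by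
    rw [← map_pow, show (2 : ZMod 19) ^ 18 = 1 by decide, map_one]
  have h9 : χ (2 : ZMod 19) ^ 9 = -1 := by
    rw [← map_pow, show (2 : ZMod 19) ^ 9 = -1 by decide]; exact hχ
  have hprim : IsPrimitiveRoot (Complex.exp (2 * Real.pi * Complex.I / 18)) 18 :=
    Complex.isPrimitiveRoot_exp 18 (by norm_num)
  obtain ⟨k, hk, hζ⟩ := hprim.eq_pow_of_pow_eq_one h18
  have eζ : Complex.exp (2 * Real.pi * Complex.I / 18) ^ k = Complex.exp (2 * Real.pi * Complex.I * ((k : ℂ) / 18)) := by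
    rw [← Complex.exp_nat_mul]; congr 1; ring
  rw [eζ] at hζ
  have hodd : ¬ (∃ j : ℕ, k = 2 * j) := by
    rintro ⟨j, rfl⟩
    have h1 : χ (2 : ZMod 19) ^ 9 = 1 := by
      rw [← hζ, ← Complex.exp_nat_mul, Complex.exp_eq_one_iff]
      exact ⟨(j : ℤ), by push_cast; ring⟩
    rw [h1] at h9
    norm_num at h9
  interval_cases k
  · exact absurd ⟨0, rfl⟩ hodd
  · refine weilPositivityOnChar_mod19_class2_one χ ?_
    rw [← hζ, Complex.exp_eq_exp_iff_exists_int]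
    exact ⟨0, by push_cast; ring⟩
  · exact absurd ⟨1, rfl⟩ hodd
  · refine weilPositivityOnChar_mod19_class8_one χ ?_
    rw [← hζ, Complex.exp_eq_exp_iff_exists_int]
    exact ⟨0, by push_cast; ring⟩
  · exact absurd ⟨2, rfl⟩ hodd
  · refine weilPositivityOnChar_mod19_class3_one_conj χ ?_
    rw [← hζ, Complex.exp_eq_exp_iff_exists_int]
    exact ⟨0, by push_cast; ring⟩
  · exact absurd ⟨3, rfl⟩ hodd
  · refine weilPositivityOnChar_mod19_class14_one χ ?_
    rw [← hζ, Complex.exp_eq_exp_iff_exists_int]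
    exact ⟨0, by push_cast; ring⟩
  · exact absurd ⟨4, rfl⟩ hodd
  · refine CellMod19One.weilPositivityOnChar_mod_nineteen_one_of_apply_two χ ?_
    rw [← hζ]
    conv_rhs => rw [DKCert.neg_one_eq_expPhase]
    rw [Complex.exp_eq_exp_iff_exists_int]
    exact ⟨0, by push_cast; ring⟩
  · exact absurd ⟨5, rfl⟩ hodd
  · refine weilPositivityOnChar_mod19_class14_one_conj χ ?_
    rw [← hζ, Complex.exp_eq_exp_iff_exists_int]
    exact ⟨1, by push_cast; ring⟩
  · exact absurd ⟨6, rfl⟩ hodd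
  · refine weilPositivityOnChar_mod19_class3_one χ ?_
    rw [← hζ, Complex.exp_eq_exp_iff_exists_int]
    exact ⟨1, by push_cast; ring⟩
  · exact absurd ⟨7, rfl⟩ hodd
  · refine weilPositivityOnChar_mod19_class8_one_conj χ ?_
    rw [← hζ, Complex.exp_eq_exp_iff_exists_int]
    exact ⟨1, by push_cast; ring⟩
  · exact absurd ⟨8, rfl⟩ hodd
  · refine weilPositivityOnChar_mod19_class2_one_conj χ ?_
    rw [← hζ, Complex.exp_eq_exp_iff_exists_int]
    exact ⟨1, by push_cast; ring⟩

/-- **Every odd Dirichlet character mod 19: Weil positivity on every window `[−t, t]`, `t ≤ 1`.** [folklore] -/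
theorem weilPositivityOnChar_mod19_of_le_one_of_odd (χ : DirichletCharacter ℂ 19) (hχ : χ.Odd) {t : ℝ} (ht : t ≤ 1) :
    WeilPositivityOnChar χ t :=
  (weilPositivityOnChar_mod19_one_of_odd χ hχ).mono ht

end Summit.Ventures.WeilGRH

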